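import Mathlib
import HarnessLib
import Summits.HubbardSuperconductivity.HubbardSuperconductivity.Theses.EnslavedA1g
import Literature.MathematicalPhysics.QuantumLattice.PairCorrelationsProofs
import Literature.MathematicalPhysics.QuantumLattice.FermionOperatorsProofs
import Literature.MathematicalPhysics.QuantumLattice.HubbardWave0LiebProofs
import Literature.MathematicalPhysics.QuantumLattice.HubbardFreePropagator

/-!
# Route `EnslavedA1g`, support `EnslavedA1gIdentity` (item `stmt-HubbardSuperconductivity-0936`)

THE ENSLAVED-A1g IDENTITY, the momentum-zero twin of Yang's `η` commutator: on the fermionic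
torus `(ℤ/Lℤ)²` with `L ≥ 3` and for every real `U`,
`2 · pairField extendedSWave L = H · P_s - P_s · H + U · P_s`,
`H = hubbardTorus 2 L 1 U`, `P_s = pairField sWave L` (`enslavedA1gIdentity_proof`).

Ingredients (all CAR bookkeeping, no spectral input):
* normal forms `P_s = √2 Σ_y c_{y↑} c_{y↓}` (`pairField_sWave_eq`) and
  `P_{s'} = (1/√2) Σ_x Σ_{e ∈ unitSteps} (c_{x↑} c_{x+e,↓} - c_{x↓} c_{x+e,↑})`
  (`pairField_extendedSWave_eq`);
* commutators of the Hubbard terms with an on-site pair annihilator: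
  `[n_{x↑} n_{x↓}, c_{z↑} c_{z↓}] = -δ_{xz} c_{z↑} c_{z↓}` (`pairNumber_commutator_pairAnnihilation`,
  adjoint of the tree's `pairNumber_commutator_pairCreation`) and
  `[Σ_σ c†_{xσ} c_{yσ}, c_{z↑} c_{z↓}] = δ_{xz} (c_{z↓} c_{y↑} - c_{z↑} c_{y↓})`
  (`hopping_commutator_pairAnnihilation`);
* the hopping term of `hubbardTorus` in unit-step form for `L ≥ 3`
  (`hoppingSum_fermionTorus_eq`, from the tree's `sum_ite_torusGraph_adj` applied entrywise; for
  `L ≤ 2` the neighbours `x ± eᵢ` coincide and the identity fails by a factor, so `2 < L` is sharp);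
* the commutator `[H, Σ_y c_{y↑} c_{y↓}] = Σ_x Σ_e (c_{x↑} c_{x+e,↓} - c_{x↓} c_{x+e,↑}) - U Σ_y c_{y↑} c_{y↓}`
  (`hubbardTorus_commutator_onsitePairSum`).

Sources: S.-C. Zhang, PRL 65 (1990) 120 (unstaggered pseudospin equation of motion);
C. N. Yang, PRL 63 (1989) 2144 (`η` commutator); D. J. Scalapino, Phys. Rep. 250 (1995) 329, §2
(pair fields). The computation itself is folklore.
-/

noncomputable section

namespace Summit.HubbardSuperconductivity.EnslavedA1g

open Matrix Finset
open Literature.Probability.LatticeModels Literature.MathematicalPhysics.QuantumLattice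
open Summit.HubbardSuperconductivity.HubbardSuperconductivity.Theses.EnslavedA1g

/-! ### The step set -/

/-- `0 ∉ unitSteps`. [folklore] -/
theorem zero_not_mem_unitSteps : (0 : Site 2) ∉ unitSteps := by
  simp only [unitSteps, mem_insert, mem_singleton, not_or]
  refine ⟨fun h => ?_, fun h => ?_, fun h => ?_, fun h => ?_⟩
  · simpa using congrFun h 0
  · simpa using congrFun h 0
  · simpa using congrFun h 1
  · simpa using congrFun h 1

/-- The on-site form factor vanishes on the unit steps. [folklore] -/
theorem sWave_of_mem_unitSteps {e : Site 2} (he : e ∈ unitSteps) : sWave e = 0 := by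
  have hne : e ≠ 0 := fun h => zero_not_mem_unitSteps (h ▸ he)
  simp [sWave, hne]

/-- `sWave 0 = 1`. [folklore] -/
@[simp] theorem sWave_zero : sWave 0 = 1 := by simp [sWave]

/-- `extendedSWave 0 = 0`. [folklore] -/
@[simp] theorem extendedSWave_zero : extendedSWave 0 = 0 := by
  simp [extendedSWave, zero_not_mem_unitSteps]

/-- `extendedSWave e = 1` on the unit steps. [folklore] -/
theorem extendedSWave_of_mem_unitSteps {e : Site 2} (he : e ∈ unitSteps) : extendedSWave e = 1 := by
  simp [extendedSWave, he]

/-- `Torus.proj L 0 = 0` (private copy of the helper of `EnslavedA1gTorusNormalForms`). [folklore] -/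
@[simp] private theorem torusProj_zero_aux (L : ℕ) : Torus.proj L (0 : Site 2) = 0 := by
  funext i
  simp [Torus.proj]

/-! ### Normal forms of the on-site and extended-`s` pair fields -/

section NormalForms

variable (L : ℕ) [NeZero L]

/-- `(1/√2) · 2 = √2` in `ℂ`. [folklore] -/
theorem ofReal_inv_sqrt_two_mul_two :
    ((1 / Real.sqrt 2 : ℝ) : ℂ) * 2 = ((Real.sqrt 2 : ℝ) : ℂ) := by
  have h : (1 / Real.sqrt 2 : ℝ) * 2 = Real.sqrt 2 := by
    rw [div_mul_eq_mul_div, one_mul, div_eq_iff (Real.sqrt_ne_zero'.2 two_pos)]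
    exact (Real.mul_self_sqrt zero_le_two).symm
  exact_mod_cast h

/-- **Normal form of the on-site pair field**: `P_s = pairField sWave L = √2 Σ_x c_{x↑} c_{x↓}`
(the `e = 0` term of `localPair`, `c_{x↓} c_{x↑} = -c_{x↑} c_{x↓}`; the unit-step terms carry
the coefficient `sWave e = 0`). Scalapino, Phys. Rep. 250 (1995) 329, §2. [folklore] -/
theorem pairField_sWave_eq :
    pairField sWave L = ((Real.sqrt 2 : ℝ) : ℂ) •
      ∑ x : TorusSite 2 L, annihilation (orb (FermionTorus.ofTorusSite x) 0) *
        annihilation (orb (FermionTorus.ofTorusSite x) 1) := by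
  unfold pairField localPair
  rw [Finset.smul_sum]
  refine Finset.sum_congr rfl fun x _ => ?_
  rw [Finset.sum_insert zero_not_mem_unitSteps, Finset.sum_eq_zero (fun e he => by
    rw [sWave_of_mem_unitSteps he]; simp), add_zero, sWave_zero, torusProj_zero_aux, add_zero,
    LiebThm1.annihilation_mul_annihilation_eq_neg (orb (FermionTorus.ofTorusSite x) 1)
      (orb (FermionTorus.ofTorusSite x) 0), sub_neg_eq_add, ← two_smul ℂ, smul_smul,
    ofReal_inv_sqrt_two_mul_two]

/-- **The extended-`s` pair field over the unit steps**:
`P_{s'} = (1/√2) Σ_x Σ_{e ∈ unitSteps} (c_{x↑} c_{x+e,↓} - c_{x↓} c_{x+e,↑})` (the `e = 0` term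
carries `extendedSWave 0 = 0`). Scalapino, Phys. Rep. 250 (1995) 329, §2. [folklore] -/
theorem pairField_extendedSWave_eq :
    pairField extendedSWave L = ((1 / Real.sqrt 2 : ℝ) : ℂ) •
      ∑ x : TorusSite 2 L, ∑ e ∈ unitSteps,
        (annihilation (orb (FermionTorus.ofTorusSite x) 0) *
            annihilation (orb (FermionTorus.ofTorusSite (x + Torus.proj L e)) 1) -
          annihilation (orb (FermionTorus.ofTorusSite x) 1) *
            annihilation (orb (FermionTorus.ofTorusSite (x + Torus.proj L e)) 0)) := by
  unfold pairField localPair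
  rw [Finset.smul_sum]
  refine Finset.sum_congr rfl fun x _ => ?_
  rw [Finset.sum_insert zero_not_mem_unitSteps, extendedSWave_zero, Finset.smul_sum]
  simp only [zero_div, Complex.ofReal_zero, zero_smul, zero_add]
  exact Finset.sum_congr rfl fun e he => by rw [extendedSWave_of_mem_unitSteps he]

end NormalForms

/-! ### Commutators of the Hubbard terms with an on-site pair annihilator -/

section Commutators

/-- `[c†_a c_b, c_p c_q] = δ_{ap} c_q c_b - δ_{aq} c_p c_b` (adjoint of `hop_pair_commutator`).
Tasaki (2020) §9.3 (commutators of fermion bilinears). [folklore] -/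
-- adapted from Summits/HubbardSuperconductivity/HubbardSuperconductivity/Theorems/NoGoSingletPairSpinAlgebra.lean
theorem bilinear_pairAnnihilation_commutator {ι : Type*} [LinearOrder ι] [Fintype ι]
    (a b p q : ι) :
    creation a * annihilation b * (annihilation p * annihilation q) -
        annihilation p * annihilation q * (creation a * annihilation b) =
      (if a = p then annihilation q * annihilation b else 0) -
        (if a = q then annihilation p * annihilation b else 0) := by
  have h := congrArg Matrix.conjTranspose (hop_pair_commutator b a q p)
  simp only [conjTranspose_sub, conjTranspose_mul, creation_conjTranspose,
    annihilation_conjTranspose, apply_ite Matrix.conjTranspose, conjTranspose_zero] at h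
  calc creation a * annihilation b * (annihilation p * annihilation q) -
        annihilation p * annihilation q * (creation a * annihilation b)
      = -(annihilation p * annihilation q * (creation a * annihilation b) -
          creation a * annihilation b * (annihilation p * annihilation q)) := by abel
    _ = -((if a = q then annihilation p * annihilation b else 0) -
          (if a = p then annihilation q * annihilation b else 0)) := by rw [h]
    _ = _ := by abel

variable {Λ : Type*} [LinearOrder Λ] [Fintype Λ]

/-- `[n_{x↑} n_{x↓}, c_{z↑} c_{z↓}] = -δ_{xz} c_{z↑} c_{z↓}` (adjoint of
`pairNumber_commutator_pairCreation`; the pair annihilator lowers the double occupancy of its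
site by one). Essler et al. (2005) §2.1, eqs. (2.8)–(2.11). [folklore] -/
theorem pairNumber_commutator_pairAnnihilation (x z : Λ) :
    numberOp x 0 * numberOp x 1 * (annihilation (orb z 0) * annihilation (orb z 1)) -
        annihilation (orb z 0) * annihilation (orb z 1) * (numberOp x 0 * numberOp x 1) =
      if x = z then -(annihilation (orb z 0) * annihilation (orb z 1)) else 0 := by
  have h := congrArg Matrix.conjTranspose (pairNumber_commutator_pairCreation x z)
  have hN : (numberOp x 0 * numberOp x 1)ᴴ = numberOp x 0 * numberOp x 1 := by
    rw [conjTranspose_mul]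
    simp only [numberOp, conjTranspose_mul, creation_conjTranspose, annihilation_conjTranspose]
    exact (numberAt_commute (orb x 1) (orb x 0)).eq
  simp only [conjTranspose_sub, conjTranspose_mul, creation_conjTranspose, hN,
    apply_ite Matrix.conjTranspose, conjTranspose_zero] at h
  -- `h : c_{z↓} c_{z↑} N - N (c_{z↓} c_{z↑}) = if x = z then c_{z↓} c_{z↑} else 0`
  rw [LiebThm1.annihilation_mul_annihilation_eq_neg (orb z 1) (orb z 0)] at h
  split_ifs at h with hxz
  · rw [if_pos hxz]
    calc numberOp x 0 * numberOp x 1 * (annihilation (orb z 0) * annihilation (orb z 1)) -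
          annihilation (orb z 0) * annihilation (orb z 1) * (numberOp x 0 * numberOp x 1)
        = -(annihilation (orb z 0) * annihilation (orb z 1)) * (numberOp x 0 * numberOp x 1) -
            numberOp x 0 * numberOp x 1 * -(annihilation (orb z 0) * annihilation (orb z 1)) := by
          noncomm_ring
      _ = _ := h
  · rw [if_neg hxz]
    calc numberOp x 0 * numberOp x 1 * (annihilation (orb z 0) * annihilation (orb z 1)) -
          annihilation (orb z 0) * annihilation (orb z 1) * (numberOp x 0 * numberOp x 1)
        = -(annihilation (orb z 0) * annihilation (orb z 1)) * (numberOp x 0 * numberOp x 1) -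
            numberOp x 0 * numberOp x 1 * -(annihilation (orb z 0) * annihilation (orb z 1)) := by
          noncomm_ring
      _ = 0 := h

/-- `[Σ_x n_{x↑} n_{x↓}, c_{z↑} c_{z↓}] = -c_{z↑} c_{z↓}`: the on-site pair annihilator lowers the
number of doubly occupied sites by one. Yang, PRL 63 (1989) 2144, eq. (6) (adjoint form);
Zhang, PRL 65 (1990) 120. [folklore] -/
theorem interaction_commutator_pairAnnihilation (z : Λ) :
    (∑ x, numberOp x 0 * numberOp x 1) * (annihilation (orb z 0) * annihilation (orb z 1)) -
        annihilation (orb z 0) * annihilation (orb z 1) * ∑ x, numberOp x 0 * numberOp x 1 =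
      -(annihilation (orb z 0) * annihilation (orb z 1)) := by
  rw [Finset.sum_mul, Finset.mul_sum, ← Finset.sum_sub_distrib]
  simp only [pairNumber_commutator_pairAnnihilation, Finset.sum_ite_eq', Finset.mem_univ, if_true]

/-- `[c†_{xσ} c_{yσ} summed over σ, c_{z↑} c_{z↓}] = δ_{xz} (c_{z↓} c_{y↑} - c_{z↑} c_{y↓})`:
the spin-summed hopping bilinear against the on-site pair annihilator.
Zhang, PRL 65 (1990) 120 (pseudospin equation of motion). [folklore] -/
theorem hopping_commutator_pairAnnihilation (x y z : Λ) :
    (∑ σ : Fin 2, creation (orb x σ) * annihilation (orb y σ)) *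
          (annihilation (orb z 0) * annihilation (orb z 1)) -
        annihilation (orb z 0) * annihilation (orb z 1) *
          ∑ σ : Fin 2, creation (orb x σ) * annihilation (orb y σ) =
      if x = z then
        annihilation (orb z 1) * annihilation (orb y 0) -
          annihilation (orb z 0) * annihilation (orb y 1)
      else 0 := by
  rw [Finset.sum_mul, Finset.mul_sum, ← Finset.sum_sub_distrib, Fin.sum_univ_two,
    bilinear_pairAnnihilation_commutator, bilinear_pairAnnihilation_commutator]
  simp only [orb_eq_orb_iff, and_true, and_false, if_false, sub_zero, zero_sub,
    Fin.zero_eq_one_iff, OfNat.ofNat_ne_one, one_ne_zero]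
  split_ifs <;> abel

end Commutators

/-! ### Nearest-neighbour sums on the torus `(ℤ/Lℤ)²`, `L ≥ 3`, over the unit steps -/

section TorusHopping

variable {L : ℕ} [NeZero L]

omit [NeZero L] in
/-- `Torus.proj L (Pi.single i 1) = Pi.single i 1` (private copy of the helper of
`EnslavedA1gTorusNormalForms`). [folklore] -/
private theorem torusProj_single_aux (i : Fin 2) :
    Torus.proj L (Pi.single i 1 : Site 2) = (Pi.single i 1 : TorusSite 2 L) := by
  funext j
  by_cases h : j = i
  · subst h; simp
  · simp [h]

omit [NeZero L] in
/-- The sum over the four unit steps `e ∈ {±e₁, ±e₂}` of `G (x + π_L e)` is the sum over the two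
axes of `G (x + eᵢ) + G (x - eᵢ)`. [folklore] -/
theorem sum_unitSteps_torus {M : Type*} [AddCommMonoid M] (x : TorusSite 2 L)
    (G : TorusSite 2 L → M) :
    ∑ e ∈ unitSteps, G (x + Torus.proj L e) =
      ∑ i : Fin 2, (G (x + Pi.single i 1) + G (x - Pi.single i 1)) := by
  have h01 : (Pi.single 0 1 : Site 2) ∉ ({-Pi.single 0 1, Pi.single 1 1, -Pi.single 1 1} :
      Finset (Site 2)) := by decide
  have h02 : (-Pi.single 0 1 : Site 2) ∉ ({Pi.single 1 1, -Pi.single 1 1} : Finset (Site 2)) := by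
    decide
  have h03 : (Pi.single 1 1 : Site 2) ∉ ({-Pi.single 1 1} : Finset (Site 2)) := by decide
  rw [unitSteps, Finset.sum_insert h01, Finset.sum_insert h02, Finset.sum_insert h03,
    Finset.sum_singleton, Fin.sum_univ_two, Torus.proj_neg, Torus.proj_neg, torusProj_single_aux,
    torusProj_single_aux, ← sub_eq_add_neg, ← sub_eq_add_neg]
  abel

/-- For `L ≥ 3`, a matrix-valued nearest-neighbour sum on the torus `(ℤ/Lℤ)²` is the sum over
the four DISTINCT neighbours `x + π_L e`, `e ∈ unitSteps` (entrywise `sum_ite_torusGraph_adj`;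
fails for `L ≤ 2`, where `x + e₁ = x - e₁`). Friedli–Velenik 2017, §3.1. [folklore] -/
theorem sum_ite_torusGraph_adj_eq_sum_unitSteps {m n : Type*} (hL : 3 ≤ L) (x : TorusSite 2 L)
    (G : TorusSite 2 L → Matrix m n ℂ) :
    (∑ y, if (torusGraph 2 L).Adj x y then G y else 0) = ∑ e ∈ unitSteps, G (x + Torus.proj L e) := by
  ext s t
  simp only [Matrix.sum_apply]
  rw [sum_unitSteps_torus x (fun y => G y s t), ← sum_ite_torusGraph_adj hL x (fun y => G y s t)]
  refine Finset.sum_congr rfl fun y _ => ?_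
  split_ifs <;> rfl

/-- **The hopping term of `hubbardTorus 2 L t U` in unit-step form** (`L ≥ 3`):
`Σ_{X,Y adjacent} Σ_σ c†_{Xσ} c_{Yσ} = Σ_x Σ_{e ∈ unitSteps} Σ_σ c†_{xσ} c_{x+e,σ}`, the sites
being parametrised by the statistical-mechanics torus through `FermionTorus.ofTorusSite`.
Friedli–Velenik 2017, §3.1; Lieb–Wu 1968. [folklore] -/
theorem hoppingSum_fermionTorus_eq (hL : 3 ≤ L) :
    (∑ X : FermionTorus 2 L, ∑ Y : FermionTorus 2 L, ∑ σ : Fin 2,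
        if (fermionTorusGraph 2 L).Adj X Y then creation (orb X σ) * annihilation (orb Y σ)
        else 0) =
      ∑ x : TorusSite 2 L, ∑ e ∈ unitSteps, ∑ σ : Fin 2,
        creation (orb (FermionTorus.ofTorusSite x) σ) *
          annihilation (orb (FermionTorus.ofTorusSite (x + Torus.proj L e)) σ) := by
  rw [← (FermionTorus.equivTorusSite (d := 2) (L := L)).symm.sum_comp]
  refine Finset.sum_congr rfl fun x _ => ?_
  rw [← (FermionTorus.equivTorusSite (d := 2) (L := L)).symm.sum_comp]
  simp only [FermionTorus.equivTorusSite, Equiv.coe_fn_symm_mk, fermionTorusGraph_adj,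
    FermionTorus.toTorusSite_ofTorusSite]
  rw [Finset.sum_comm, Finset.sum_comm (s := unitSteps)]
  refine Finset.sum_congr rfl fun σ _ => ?_
  exact sum_ite_torusGraph_adj_eq_sum_unitSteps hL x
    (fun y => creation (orb (FermionTorus.ofTorusSite x) σ) *
      annihilation (orb (FermionTorus.ofTorusSite y) σ))

/-- `FermionTorus.ofTorusSite` is injective. [folklore] -/
theorem ofTorusSite_eq_iff {x y : TorusSite 2 L} :
    FermionTorus.ofTorusSite x = FermionTorus.ofTorusSite y ↔ x = y :=
  (FermionTorus.equivTorusSite (d := 2) (L := L)).symm.injective.eq_iff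

end TorusHopping

/-! ### The commutator of the Hubbard Hamiltonian with the on-site pair sum -/

section MainCommutator

variable {L : ℕ} [NeZero L]

/-- **`[H, Σ_y c_{y↑} c_{y↓}] = Σ_x Σ_{e ∈ unitSteps} (c_{x↑} c_{x+e,↓} - c_{x↓} c_{x+e,↑}) -
U Σ_y c_{y↑} c_{y↓}`** for `H = hubbardTorus 2 L 1 U`, `L ≥ 3`: the hopping term contributes the
(unnormalised) extended-`s` pair sum (`hopping_commutator_pairAnnihilation`, summed with
`hoppingSum_fermionTorus_eq`), the interaction `-U` times the on-site pair sum
(`interaction_commutator_pairAnnihilation`). Zhang, PRL 65 (1990) 120 (pseudospin equation of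
motion, unstaggered); Yang, PRL 63 (1989) 2144. [folklore] -/
theorem hubbardTorus_commutator_onsitePairSum (hL : 3 ≤ L) (U : ℝ) :
    hubbardTorus 2 L 1 U *
          (∑ y : TorusSite 2 L, annihilation (orb (FermionTorus.ofTorusSite y) 0) *
            annihilation (orb (FermionTorus.ofTorusSite y) 1)) -
        (∑ y : TorusSite 2 L, annihilation (orb (FermionTorus.ofTorusSite y) 0) *
            annihilation (orb (FermionTorus.ofTorusSite y) 1)) * hubbardTorus 2 L 1 U =
      (∑ x : TorusSite 2 L, ∑ e ∈ unitSteps,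
          (annihilation (orb (FermionTorus.ofTorusSite x) 0) *
              annihilation (orb (FermionTorus.ofTorusSite (x + Torus.proj L e)) 1) -
            annihilation (orb (FermionTorus.ofTorusSite x) 1) *
              annihilation (orb (FermionTorus.ofTorusSite (x + Torus.proj L e)) 0))) -
        (U : ℂ) • ∑ y : TorusSite 2 L, annihilation (orb (FermionTorus.ofTorusSite y) 0) *
            annihilation (orb (FermionTorus.ofTorusSite y) 1) := by
  -- abbreviations
  set Δ : Matrix (Finset (Orb (FermionTorus 2 L))) (Finset (Orb (FermionTorus 2 L))) ℂ :=
    ∑ y : TorusSite 2 L, annihilation (orb (FermionTorus.ofTorusSite y) 0) *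
      annihilation (orb (FermionTorus.ofTorusSite y) 1) with hΔ
  set T : Matrix (Finset (Orb (FermionTorus 2 L))) (Finset (Orb (FermionTorus 2 L))) ℂ :=
    ∑ x : TorusSite 2 L, ∑ e ∈ unitSteps, ∑ σ : Fin 2,
      creation (orb (FermionTorus.ofTorusSite x) σ) *
        annihilation (orb (FermionTorus.ofTorusSite (x + Torus.proj L e)) σ) with hT
  set D : Matrix (Finset (Orb (FermionTorus 2 L))) (Finset (Orb (FermionTorus 2 L))) ℂ :=
    ∑ X : FermionTorus 2 L, numberOp X 0 * numberOp X 1 with hD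
  -- the two commutators
  have hTΔ : T * Δ - Δ * T = ∑ x : TorusSite 2 L, ∑ e ∈ unitSteps,
      (annihilation (orb (FermionTorus.ofTorusSite x) 1) *
          annihilation (orb (FermionTorus.ofTorusSite (x + Torus.proj L e)) 0) -
        annihilation (orb (FermionTorus.ofTorusSite x) 0) *
          annihilation (orb (FermionTorus.ofTorusSite (x + Torus.proj L e)) 1)) := by
    rw [hT, Finset.sum_mul, Finset.mul_sum, ← Finset.sum_sub_distrib]
    refine Finset.sum_congr rfl fun x _ => ?_
    rw [Finset.sum_mul, Finset.mul_sum, ← Finset.sum_sub_distrib]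
    refine Finset.sum_congr rfl fun e _ => ?_
    rw [hΔ, Finset.mul_sum, Finset.sum_mul, ← Finset.sum_sub_distrib]
    simp only [hopping_commutator_pairAnnihilation, ofTorusSite_eq_iff, Finset.sum_ite_eq,
      Finset.mem_univ, if_true]
  have hDΔ : D * Δ - Δ * D = -Δ := by
    rw [hΔ, Finset.mul_sum, Finset.sum_mul, ← Finset.sum_sub_distrib, ← Finset.sum_neg_distrib]
    refine Finset.sum_congr rfl fun y _ => ?_
    rw [hD]
    exact interaction_commutator_pairAnnihilation (FermionTorus.ofTorusSite y)
  -- the Hamiltonian in unit-step form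
  have hH : hubbardTorus 2 L 1 U = -T + (U : ℂ) • D := by
    unfold hubbardTorus hamiltonian
    rw [hoppingSum_fermionTorus_eq hL, Complex.ofReal_one, neg_smul, one_smul]
  rw [hH]
  calc (-T + (U : ℂ) • D) * Δ - Δ * (-T + (U : ℂ) • D)
      = -(T * Δ - Δ * T) + (U : ℂ) • (D * Δ - Δ * D) := by
        rw [add_mul, mul_add, neg_mul, mul_neg, smul_mul_assoc, mul_smul_comm, smul_sub]
        abel
    _ = _ := by
        rw [hTΔ, hDΔ, smul_neg, ← sub_eq_add_neg, ← Finset.sum_neg_distrib]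
        congr 1
        refine Finset.sum_congr rfl fun x _ => ?_
        rw [← Finset.sum_neg_distrib]
        exact Finset.sum_congr rfl fun e _ => neg_sub _ _

/-- **`EnslavedA1gIdentity` (route `EnslavedA1g`, item 0936).** On the torus `(ℤ/Lℤ)²` with
`L ≥ 3` and every real `U`: `2 · pairField extendedSWave L = H P_s - P_s H + U P_s` with
`H = hubbardTorus 2 L 1 U`, `P_s = pairField sWave L` — the momentum-zero ("unstaggered") twin of
Yang's `η` commutator: the A1g bond pair field is the velocity of the on-site pair field. Proof:
`P_s = √2 Σ_y c_{y↑} c_{y↓}` (`pairField_sWave_eq`),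
`P_{s'} = (1/√2) Σ_x Σ_e (c_{x↑} c_{x+e,↓} - c_{x↓} c_{x+e,↑})` (`pairField_extendedSWave_eq`), and
`hubbardTorus_commutator_onsitePairSum`. Zhang, PRL 65 (1990) 120; Yang, PRL 63 (1989) 2144.
[folklore] -/
theorem enslavedA1gIdentity_proof : EnslavedA1gIdentity := by
  intro L _ hL U
  rw [pairField_extendedSWave_eq, pairField_sWave_eq, mul_smul_comm, smul_mul_assoc, ← smul_sub,
    hubbardTorus_commutator_onsitePairSum (by omega) U, smul_sub, smul_smul, smul_smul, smul_smul,
    mul_comm ((Real.sqrt 2 : ℝ) : ℂ) (U : ℂ), sub_add_cancel, mul_comm (2 : ℂ),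
    ofReal_inv_sqrt_two_mul_two]

end MainCommutator

end Summit.HubbardSuperconductivity.EnslavedA1g

end
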